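import Literature.Combinatorics.StablePolynomials.RealRootedBernoulliSum
import Mathlib.Algebra.Group.ForwardDiff
import HarnessLib

/-!
# The sample-size step of the hypergeometric law is an `x`-difference of the neighbouring law

For the urn with `b` marked and `d` unmarked balls and `r` draws without replacement, the (unnormalised)
hypergeometric generating polynomial is `H_{b,d,r}(X) = Σ_k C(b,k) C(d,r−k) X^k` (`hyperGen`, lit g31) and the
law is `law_{b,d,r} = H_{b,d,r}/C(b+d,r)` (`hyperLaw` below).  This file proves the **sample-size step**

  `(r+1)·H_{b+1,d,r+1} = (b+1+d−r)·H_{b+1,d,r} − (b+1)·(1−X)·H_{b,d,r}`            (`hyperGen_sampleSize_step`)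

(a Gauss contiguous relation for the `₂F₁` behind the hypergeometric pgf, here obtained from the urn generating
function `U_{b,d}(Y) = (1 + X·Y)^b (1+Y)^d ∈ ℝ[X][Y]`, whose `Y^r`-coefficient is `H_{b,d,r}`
(`coeff_urnGF`), via the first-order ODE `(1+Y)·U′_{b+1,d} = (b+1+d)·U_{b+1,d} − (b+1)(1−X)·U_{b,d}`
(`urnGF_ode`)), and its normalised form

  `law_{b+1,d,r+1} − law_{b+1,d,r} = −((b+1)/(b+1+d)) · (1−X) · law_{b,d,r}`   (`r ≤ b+d`; `hyperLaw_sampleSize_step`):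

ONE MORE DRAW changes the hypergeometric law by `−(b+1)/(b+1+d)` times the FIRST `x`-DIFFERENCE of the law of
the urn with one marked ball fewer.  Iterating (`hyperLaw_sampleSize_iter`):

  `Δ_r^γ [r ↦ law_{b+γ,d,r}](r) = (−1)^γ · Π_{i<γ} (b+γ−i)/(b+γ+d−i) · (1−X)^γ · law_{b,d,r}`   (`r + γ ≤ b + γ + d`).

USE (cell pnp-psdrank, lit g33 LIT-49; the analytic input of the two-block chain CG2SYM): a Guldberg bivariate
hypergeometric law `L(i,j) = C(m₁,i)C(m₂,j)C(m₀,r−i−j)/C(M,r)` factors as `p₂(j)·law_{m₁,m₀,r−j}(i)`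
[Kocherlakota–Kocherlakota 2017, eq. (6.3.12)], so by the identity above every MIXED difference `∇₁^a ∇₂^b L`
is a signed binomial combination of products of ONE-DIMENSIONAL differences `∇^β p₂` and
`(1−X)^{a+b−β}·law_{m₁−γ,m₀,·}`, each bounded in `ℓ¹` by `Probability/Distributions/PoissonBinomialDifferences`
(`hypergeometric_absCoeffSum_le`): no bivariate local limit theory is needed.

All PROVED, 0 sorry; definitions: `urnGF`, `hyperLaw` (bookkeeping); no named facts.

## References
* [KocherlakotaKocherlakota2017] S. Kocherlakota, K. Kocherlakota, *Bivariate Discrete Distributions*, CRC 2017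
  (reprint of Dekker 1992), §6.3.2 eq. (6.3.10)–(6.3.13) (marginals and conditionals of the bivariate
  hypergeometric are univariate hypergeometric), §6.4 eq. (6.4.1) (the pgf as `₂F₁(−n,−N₁;N−N₁−n+1;t)`).
* [AndrewsAskeyRoy1999] G. Andrews, R. Askey, R. Roy, *Special Functions*, CUP 1999, §2.5 (contiguous relations
  of `₂F₁`).
* [VatutinMikhailov1983] V. A. Vatutin, V. G. Mikhailov, Theory Probab. Appl. 27 (1983), §2 (the polynomial `H`).
-/

noncomputable section

open Finset Polynomial

namespace Literature.Combinatorics.StablePolynomials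

/-! ### §1 The urn generating function and its `Y`-coefficients -/

/-- The two-colour urn generating function `U_{b,d}(Y) = (1 + X·Y)^b · (1 + Y)^d ∈ ℝ[X][Y]` (outer variable
`Y`, inner variable `X` marking the marked balls). [cite: KocherlakotaKocherlakota2017, §6.4 eq. (6.4.1)] -/
def urnGF (b d : ℕ) : Polynomial (Polynomial ℝ) :=
  (1 + C X * Polynomial.X) ^ b * (1 + Polynomial.X) ^ d

/-- `Y^k`-coefficient of `(1 + c·Y)^n` is `C(n,k)·c^k` (any commutative semiring of coefficients; the tree's
`Literature/Analysis/TotalPositivity/PolyaFrequencyReciprocal.coeff_one_add_C_mul_X_pow` is the case `R = ℝ`). [folklore] -/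
private theorem coeff_one_add_C_mul_X_pow' {R : Type*} [CommSemiring R] (c : R) (n k : ℕ) :
    ((1 + C c * Polynomial.X) ^ n).coeff k = (n.choose k : R) * c ^ k := by
  rw [add_comm, add_pow]
  simp only [one_pow, mul_one, finsetSum_coeff]
  rw [Finset.sum_eq_single k]
  · rw [mul_pow, ← C_pow, mul_comm, ← mul_assoc, ← C_eq_natCast, ← C_mul, coeff_C_mul_X_pow, if_pos rfl,
      mul_comm]
  · intro m _ hmk
    rw [mul_pow, ← C_pow, mul_comm, ← mul_assoc, ← C_eq_natCast, ← C_mul, coeff_C_mul_X_pow, if_neg (Ne.symm hmk)]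
  · intro hk
    rw [mem_range, not_lt] at hk
    rw [Nat.choose_eq_zero_of_lt (by omega), Nat.cast_zero, mul_zero, coeff_zero]

/-- **The urn generating function generates the hypergeometric polynomials**: the `Y^r`-coefficient of
`(1 + X·Y)^b (1+Y)^d` is `H_{b,d,r} = Σ_k C(b,k)C(d,r−k) X^k`. [cite: KocherlakotaKocherlakota2017, §6.4 eq. (6.4.1)] -/
theorem coeff_urnGF (b d r : ℕ) : (urnGF b d).coeff r = hyperGen b d r := by
  rw [urnGF, coeff_mul, Finset.Nat.sum_antidiagonal_eq_sum_range_succ_mk, hyperGen]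
  refine sum_congr rfl fun k hk => ?_
  rw [coeff_one_add_C_mul_X_pow', coeff_one_add_X_pow, Nat.cast_mul, C_mul, C_eq_natCast, C_eq_natCast]
  ring

/-! ### §2 The ODE of the urn generating function and the sample-size step -/

/-- The first-order ODE in `Y`: `(1+Y)·U′_{b+1,d} = (b+1+d)·U_{b+1,d} − (b+1)(1−X)·U_{b,d}`.
[cite: AndrewsAskeyRoy1999, §2.5] -/
theorem urnGF_ode (b d : ℕ) :
    (1 + Polynomial.X) * derivative (urnGF (b + 1) d) =
      C (C ((b : ℝ) + 1 + d)) * urnGF (b + 1) d - C (C ((b : ℝ) + 1) * (1 - X)) * urnGF b d := by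
  have hA : derivative (1 + C X * Polynomial.X : Polynomial (Polynomial ℝ)) = C X := by
    rw [derivative_add, derivative_one, derivative_C_mul_X, zero_add]
  have hB : derivative (1 + Polynomial.X : Polynomial (Polynomial ℝ)) = 1 := by
    rw [derivative_add, derivative_one, derivative_X, zero_add]
  rcases Nat.eq_zero_or_pos d with rfl | hd
  · simp only [urnGF, pow_zero, mul_one, derivative_pow_succ, hA, Nat.cast_zero, add_zero, map_add, map_one,
      map_natCast, map_sub, map_mul]
    ring
  · obtain ⟨d', rfl⟩ : ∃ d', d = d' + 1 := ⟨d - 1, by omega⟩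
    simp only [urnGF, derivative_mul, derivative_pow_succ, hA, hB, mul_one, map_add, map_one,
      map_natCast, map_sub, map_mul, Nat.cast_add, Nat.cast_one]
    ring

/-- **The sample-size step** (unnormalised): for all `b d r`,
`(r+1)·H_{b+1,d,r+1} = (b+1+d−r)·H_{b+1,d,r} − (b+1)·(1−X)·H_{b,d,r}`.
(Coefficient of `Y^r` in `urnGF_ode`.) [cite: AndrewsAskeyRoy1999, §2.5] [cite: KocherlakotaKocherlakota2017, §6.4] -/
theorem hyperGen_sampleSize_step (b d r : ℕ) :
    ((r : ℝ) + 1) • hyperGen (b + 1) d (r + 1) =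
      ((b : ℝ) + 1 + d - r) • hyperGen (b + 1) d r - ((b : ℝ) + 1) • ((1 - X) * hyperGen b d r) := by
  have h := congrArg (fun P => P.coeff r) (urnGF_ode b d)
  simp only [coeff_sub, coeff_C_mul, coeff_urnGF] at h
  -- left-hand side: `((1+Y)U′).coeff r = (r+1) H_{r+1} + r H_r`
  have hL : ((1 + Polynomial.X) * derivative (urnGF (b + 1) d)).coeff r =
      C ((r : ℝ) + 1) * hyperGen (b + 1) d (r + 1) + C (r : ℝ) * hyperGen (b + 1) d r := by
    rw [add_mul, one_mul, coeff_add, coeff_derivative, coeff_urnGF]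
    rcases r with _ | r'
    · simp
    · rw [coeff_X_mul, coeff_derivative, coeff_urnGF]
      simp only [Nat.cast_add, Nat.cast_one, map_add, map_one, map_natCast]
      ring
  rw [hL] at h
  simp only [smul_eq_C_mul, map_add, map_sub, map_one, map_natCast] at h ⊢
  linear_combination h

/-! ### §3 The normalised law and its sample-size step -/

/-- The hypergeometric LAW as a generating polynomial: `law_{b,d,r} = H_{b,d,r}/C(b+d,r)`; its `k`-th coefficient
is `C(b,k)C(d,r−k)/C(b+d,r) = hypergeomPMFReal (b+d) b r k` for `k ≤ r`. [cite: KocherlakotaKocherlakota2017, §6.3.2 eq. (6.3.10)] -/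
def hyperLaw (b d r : ℕ) : Polynomial ℝ := (((b + d).choose r : ℕ) : ℝ)⁻¹ • hyperGen b d r

/-- Coefficients of the law polynomial. [cite: KocherlakotaKocherlakota2017, §6.3.2 eq. (6.3.10)] -/
theorem coeff_hyperLaw (b d r k : ℕ) :
    (hyperLaw b d r).coeff k =
      if k ≤ r then ((b.choose k * d.choose (r - k) : ℕ) : ℝ) / ((b + d).choose r : ℕ) else 0 := by
  rw [hyperLaw, coeff_smul, coeff_hyperGen, smul_eq_mul]
  split_ifs
  · rw [inv_mul_eq_div]
  · rw [mul_zero]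

/-- Bridge to the tree's `hypergeomPMFReal`: for `k ≤ r`, the `k`-th coefficient of `law_{b,d,r}` is
`hypergeomPMFReal (b+d) b r k`. [cite: KocherlakotaKocherlakota2017, §6.3.2 eq. (6.3.10)] -/
theorem coeff_hyperLaw_eq_hypergeomPMFReal {b d r k : ℕ} (hk : k ≤ r) :
    (hyperLaw b d r).coeff k = Literature.Probability.Distributions.hypergeomPMFReal (b + d) b r k := by
  rw [coeff_hyperLaw, if_pos hk, Literature.Probability.Distributions.hypergeomPMFReal, Nat.add_sub_cancel_left,
    Nat.cast_mul]

/-- The law polynomial sums to one (`r ≤ b+d`). [cite: KocherlakotaKocherlakota2017, §6.3.2] -/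
theorem eval_one_hyperLaw {b d r : ℕ} (hr : r ≤ b + d) : (hyperLaw b d r).eval 1 = 1 := by
  rw [hyperLaw, eval_smul, eval_one_hyperGen, smul_eq_mul]
  have : (0 : ℝ) < ((b + d).choose r : ℕ) := by exact_mod_cast Nat.choose_pos hr
  exact inv_mul_cancel₀ this.ne'

/-- `C(M, r+1)·(r+1) = C(M, r)·(M − r)` in `ℝ` (for `r ≤ M`, so no truncated subtraction). [folklore] -/
private theorem choose_succ_mul_cast {M r : ℕ} (hr : r ≤ M) :
    ((M.choose (r + 1) : ℕ) : ℝ) * ((r : ℝ) + 1) = (M.choose r : ℕ) * ((M : ℝ) - r) := by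
  have h := Nat.choose_succ_right_eq M r
  have h' : ((M.choose (r + 1) * (r + 1) : ℕ) : ℝ) = ((M.choose r * (M - r) : ℕ) : ℝ) := by rw [h]
  push_cast [Nat.cast_sub hr] at h'
  exact h'

/-- `C(b+d, r)·(b+1+d) = C(b+1+d, r)·(b+1+d−r)` in `ℝ` (for `r ≤ b+d`). [folklore] -/
private theorem choose_mul_succ_cast {b d r : ℕ} (hr : r ≤ b + d) :
    (((b + d).choose r : ℕ) : ℝ) * ((b : ℝ) + 1 + d) = ((b + 1 + d).choose r : ℕ) * ((b : ℝ) + 1 + d - r) := by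
  have h := Nat.choose_mul_succ_eq (b + d) r
  have e : b + d + 1 = b + 1 + d := by ring
  rw [e] at h
  have h' : (((b + d).choose r * (b + 1 + d) : ℕ) : ℝ) = (((b + 1 + d).choose r * (b + 1 + d - r) : ℕ) : ℝ) := by rw [h]
  push_cast [Nat.cast_sub (show r ≤ b + 1 + d by omega)] at h'
  linear_combination h'

/-- **The sample-size step for the law**: for `r ≤ b + d`,
`law_{b+1,d,r+1} − law_{b+1,d,r} = −((b+1)/(b+1+d)) · (1−X) · law_{b,d,r}` — one more draw changes the
hypergeometric law by a multiple (of modulus `≤ 1`) of the first `x`-difference of the law of the urn with one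
marked ball fewer. [cite: AndrewsAskeyRoy1999, §2.5] [cite: KocherlakotaKocherlakota2017, §6.4] -/
theorem hyperLaw_sampleSize_step {b d r : ℕ} (hr : r ≤ b + d) :
    hyperLaw (b + 1) d (r + 1) - hyperLaw (b + 1) d r =
      (-(((b : ℝ) + 1) / ((b : ℝ) + 1 + d))) • ((1 - X) * hyperLaw b d r) := by
  have hM0 : (0 : ℝ) < ((b + 1 + d).choose r : ℕ) := by exact_mod_cast Nat.choose_pos (by omega)
  have hM1 : (0 : ℝ) < ((b + 1 + d).choose (r + 1) : ℕ) := by exact_mod_cast Nat.choose_pos (by omega)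
  have hN0 : (0 : ℝ) < ((b + d).choose r : ℕ) := by exact_mod_cast Nat.choose_pos hr
  have hr1 : (0 : ℝ) < (r : ℝ) + 1 := by positivity
  have hBD : (0 : ℝ) < (b : ℝ) + 1 + d := by positivity
  have hstep := hyperGen_sampleSize_step b d r
  have c1 := choose_succ_mul_cast (show r ≤ b + 1 + d by omega)
  have c2 := choose_mul_succ_cast hr
  -- express the three `hyperGen`s through the laws
  have g1 : hyperGen (b + 1) d (r + 1) = (((b + 1 + d).choose (r + 1) : ℕ) : ℝ) • hyperLaw (b + 1) d (r + 1) := by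
    rw [hyperLaw, smul_smul, mul_inv_cancel₀ hM1.ne', one_smul]
  have g0 : hyperGen (b + 1) d r = (((b + 1 + d).choose r : ℕ) : ℝ) • hyperLaw (b + 1) d r := by
    rw [hyperLaw, smul_smul, mul_inv_cancel₀ hM0.ne', one_smul]
  have gb : hyperGen b d r = (((b + d).choose r : ℕ) : ℝ) • hyperLaw b d r := by
    rw [hyperLaw, smul_smul, mul_inv_cancel₀ hN0.ne', one_smul]
  rw [g1, g0, gb, smul_smul, smul_smul, mul_smul_comm, smul_smul] at hstep
  -- `hstep : ((r+1)·C(M,r+1)) • law₁ = ((M−r)·C(M,r)) • law₀ − ((b+1)·C(b+d,r)) • ((1−X)·law_b)`; divide by `(r+1)C(M,r+1) = (M−r)C(M,r)`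
  have hK : ((r : ℝ) + 1) * ((b + 1 + d).choose (r + 1) : ℕ) = ((b : ℝ) + 1 + d - r) * ((b + 1 + d).choose r : ℕ) := by
    rw [mul_comm, c1]; push_cast; ring
  have hKpos : 0 < ((r : ℝ) + 1) * ((b + 1 + d).choose (r + 1) : ℕ) := mul_pos hr1 hM1
  rw [← hK] at hstep
  have := congrArg (fun P => (((r : ℝ) + 1) * ((b + 1 + d).choose (r + 1) : ℕ))⁻¹ • P) hstep
  simp only [smul_sub, inv_smul_smul₀ hKpos.ne', smul_smul] at this
  rw [this, sub_sub_cancel_left, ← neg_smul]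
  congr 1
  have hne : (b : ℝ) + 1 + d - r ≠ 0 := by
    have : (r : ℝ) ≤ (b : ℝ) + d := by exact_mod_cast hr
    linarith
  have hM0' : (((b + 1 + d).choose r : ℕ) : ℝ) ≠ 0 := hM0.ne'
  have hBD' : (b : ℝ) + 1 + d ≠ 0 := hBD.ne'
  rw [hK, neg_inj, inv_mul_eq_div, div_eq_div_iff (mul_ne_zero hne hM0') hBD']
  linear_combination ((b : ℝ) + 1) * c2

/-! ### §4 Iteration: `γ` more draws = the `γ`-th `x`-difference of the law with `γ` fewer marked balls -/

/-- **The iterated sample-size step**: for `r + γ ≤ b + γ + d`... stated with `B = b + γ` marked balls: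
`Δ_{(1)}^γ [r ↦ law_{b+γ,d,r}](r) = ((−1)^γ · Π_{i<γ} (b+γ−i)/(b+γ−i+d)) • ((1−X)^γ · law_{b,d,r})`
whenever `r + γ ≤ b + γ + d` (`Δ_{(1)}` = Mathlib `fwdDiff 1`). [cite: AndrewsAskeyRoy1999, §2.5] -/
theorem hyperLaw_sampleSize_iter (b d : ℕ) :
    ∀ (γ r : ℕ), r + γ ≤ b + γ + d →
      (fwdDiff 1)^[γ] (fun r' => hyperLaw (b + γ) d r') r =
        (((-1 : ℝ) ^ γ) * ∏ i ∈ range γ, (((b + γ - i : ℕ) : ℝ) / (((b + γ - i : ℕ) : ℝ) + d))) •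
          ((1 - X) ^ γ * hyperLaw b d r) := by
  intro γ
  induction γ generalizing b with
  | zero => intro r _; simp
  | succ γ ih =>
      intro r hr
      rw [Function.iterate_succ_apply']
      -- `Δ^γ` of the profile with `b+γ+1` marked balls, at `r` and `r+1`, by the induction hypothesis for `b+1`
      have e : b + (γ + 1) = (b + 1) + γ := by ring
      have h0 := ih (b + 1) r (by omega)
      have h1 := ih (b + 1) (r + 1) (by omega)
      rw [fwdDiff, e, h1, h0, ← smul_sub, ← mul_sub, hyperLaw_sampleSize_step (by omega), mul_smul_comm, smul_smul]
      congr 1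
      · rw [prod_range_succ, Nat.add_sub_cancel]
        push_cast
        ring
      · ring

end Literature.Combinatorics.StablePolynomials

end
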